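import Mathlib.Analysis.InnerProductSpace.PiL2
import Literature.Computability.QuantumComplexity.ExactQuantumQuery
import Literature.Computability.Complexity.BlockSensitivity
import HarnessLib

/-!
# Block sensitivity lower-bounds bounded-error quantum query complexity (hybrid argument)

Beals–Buhrman–Cleve–Mosca–de Wolf, *Quantum lower bounds by polynomials*, J. ACM 48 (2001),
Theorem 4.13: "If `f` is a Boolean function, then `Q_E(f) ≥ √(bs(f)/8)` and
`Q₂(f) ≥ √(bs(f)/16)`", with the printed remark (footnote to §4.3, p. 9 of
arXiv:quant-ph/9802049): "This theorem can also be proved by an argument similar to the lower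
bound proof for database searching in [BBBV]". This file PROVES the theorem in that second way —
the hybrid argument of Bennett–Bernstein–Brassard–Vazirani (SIAM J. Comput. 26 (1997), Thm. 3.3)
— for the tree's query model `QQueryAlg` (`QuantumQuery.lean`), with the (weaker, absolute)
constant that the hybrid argument yields:

* `blockSensitivity_le_of_computesWithError`: if `A` computes the total function `f` with error
  `1/3` on every input, then `bs(f) ≤ 144 · T²`, `T = A.queries`;
* `blockSensitivity_le_quantumQueryComplexity_sq`: `bs(f) ≤ 144 · Q₂(f)²` (`N ≥ 1`).

The printed constant `16` of Theorem 4.13 comes from the polynomial method together with the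
Ehlich–Zeller/Rivlin–Cheney inequality (Beals et al. Thm. 4.12), which rests on Markov's
inequality for real polynomials; that inequality is not in Mathlib or the tree, so the constant
`16` is NOT obtained here. Only the form `bs(f) = O(Q₂(f)²)` is used downstream
(`D(f) = O(Q₂(f)⁶)`, Buhrman–de Wolf 2002, Corollary 4; tree fact
`detQueryComplexity_le_pow_six`).

**The argument** (BBBV Thm. 3.3, in the form of Beals et al.'s remark). Write `ψ_t^x` for the
state of `A` on input `x` after `t` rounds (`stateAt`; `finalState = ψ_T`,
`finalState_eq_stateAt`). For inputs `x` and `x^B` (the block `B` flipped) the states evolve by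
the same unitaries and differ only through the oracle, so by unitarity and the triangle
inequality `‖ψ_T^x − ψ_T^{x^B}‖ ≤ ∑_{t<T} ‖(O_x − O_{x^B}) ψ_t^x‖` (`l2Norm'_stateAt_sub_le_sum`), and
one modified query costs `‖(O_x − O_{x^B}) ψ‖ ≤ 2 √(m_B(ψ))`, `m_B(ψ)` the query magnitude of the
block (`queryMagnitude`, BBBV Def. 3.2; `l2Norm'_oracle_sub_le`). If `B` is sensitive, the
acceptance probabilities of `x` and `x^B` differ by `≥ 1/3`, while
`|P(x) − P(y)| ≤ 2 ‖ψ_T^x − ψ_T^y‖` (`abs_acceptProb_sub_le`), so `‖ψ_T^x − ψ_T^{x^B}‖ ≥ 1/6`.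
For `b` pairwise disjoint sensitive blocks the magnitudes add up to at most `‖ψ‖² = 1`
(`sum_queryMagnitude_le`), whence by Cauchy–Schwarz `b/6 ≤ 2 ∑_{t<T} ∑_B √(m_B(ψ_t)) ≤ 2T√b`,
i.e. `b ≤ 144 T²` (`card_le_of_isSensitiveFamily`).

Mathlib supplies `EuclideanSpace` (the `ℓ²`-norm; the plain function type carries the sup
norm), `Real.sum_sqrt_mul_sqrt_le` (Cauchy–Schwarz), `Matrix.unitaryGroup`; the tree supplies
the model (`QuantumQuery.lean`), unitarity of the evolution (`PolynomialMethod.lean`), the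
attainment of `Q_ε(f)` (`ExactQuantumQuery.lean`) and block sensitivity (`BlockSensitivity.lean`);
the `ℓ²`-norm `l2Norm'` generalises `l2Norm` of `HybridArgument.lean` (register states) to an
arbitrary finite basis.

## References

* R. Beals, H. Buhrman, R. Cleve, M. Mosca, R. de Wolf, *Quantum lower bounds by polynomials*,
  J. ACM 48 (2001) 778–797, Def. 4.11, Thm. 4.13 and the footnote preceding Thm. 4.12
  (arXiv:quant-ph/9802049, pp. 8–9) [BealsEtAl2001].
* C. H. Bennett, E. Bernstein, G. Brassard, U. Vazirani, *Strengths and weaknesses of quantum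
  computing*, SIAM J. Comput. 26 (1997) 1510–1523, Def. 3.2, Thm. 3.3
  [BennettBernsteinBrassardVazirani1997].
* H. Buhrman, R. de Wolf, *Complexity measures and decision tree complexity: a survey*,
  Theoret. Comput. Sci. 288 (2002) 21–43, §5.3, Corollary 4 [BuhrmanDewolf2002].
-/

namespace Literature.Computability.QuantumComplexity

open Matrix Finset Literature.Computability.Cryptography Literature.Computability.Complexity

/-! ### The `ℓ²`-norm of an amplitude vector -/

section L2

variable {ι : Type*} [Fintype ι]

/-- The `ℓ²`-norm `‖v‖₂ = (∑ᵢ |vᵢ|²)^{1/2}` of an amplitude vector indexed by an arbitrary finite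
type `ι`, i.e. its norm in `EuclideanSpace ℂ ι` (the plain function type `ι → ℂ` carries the sup
norm). This GENERALISES `l2Norm` of `HybridArgument.lean` (same namespace), which is the special
case `ι = QReg N` of register states: for `ψ : QReg N → ℂ` one has `l2Norm ψ = l2Norm' ψ` by
`rfl` (both are `‖WithLp.toLp 2 ψ‖`); the query model needs `ι = Fin N × Bool × W`. The lemma
names below mirror the `l2Norm_*` API (`l2Norm'_nonneg`, `l2Norm'_sq`, `l2Norm'_sub_le`, …);
making `l2Norm` an abbreviation of `l2Norm'` is left to a librarian (it would only add the heavy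
circuit imports of `HybridArgument.lean` here). [folklore] -/
noncomputable def l2Norm' (v : ι → ℂ) : ℝ := ‖(WithLp.toLp 2 v : EuclideanSpace ℂ ι)‖

/-- `‖v‖₂ ≥ 0`. [folklore] -/
theorem l2Norm'_nonneg (v : ι → ℂ) : 0 ≤ l2Norm' v := norm_nonneg _

/-- `‖v‖₂² = ∑ᵢ |vᵢ|²`. [folklore] -/
theorem l2Norm'_sq (v : ι → ℂ) : l2Norm' v ^ 2 = ∑ i, ‖v i‖ ^ 2 := by
  rw [l2Norm', EuclideanSpace.norm_sq_eq]

/-- `‖v‖₂ = √(∑ᵢ |vᵢ|²)`. [folklore] -/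
theorem l2Norm'_eq_sqrt (v : ι → ℂ) : l2Norm' v = Real.sqrt (∑ i, ‖v i‖ ^ 2) := by
  rw [← l2Norm'_sq, Real.sqrt_sq (l2Norm'_nonneg v)]

/-- Triangle inequality through an intermediate point. [folklore] -/
theorem l2Norm'_sub_le (a b c : ι → ℂ) : l2Norm' (a - c) ≤ l2Norm' (a - b) + l2Norm' (b - c) := by
  simp only [l2Norm', WithLp.toLp_sub]
  exact norm_sub_le_norm_sub_add_norm_sub _ _ _

/-- `‖0‖₂ = 0`. [folklore] -/
theorem l2Norm'_zero : l2Norm' (0 : ι → ℂ) = 0 := by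
  simp [l2Norm']

variable [DecidableEq ι]

/-- Unitary matrices preserve the `ℓ²`-norm. [folklore] -/
theorem l2Norm'_mulVec_of_mem_unitaryGroup {U : Matrix ι ι ℂ} (hU : U ∈ Matrix.unitaryGroup ι ℂ)
    (v : ι → ℂ) : l2Norm' (U *ᵥ v) = l2Norm' v := by
  rw [l2Norm'_eq_sqrt, l2Norm'_eq_sqrt, sum_norm_sq_mulVec_of_mem_unitaryGroup hU]

end L2

/-! ### The run of a query algorithm as a sequence of states -/

variable {N : ℕ}

/-- The `k`-th unitary `U_k` of `A` as a matrix (`k ≤ T`; the identity for `k > T`, a junk value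
never used). [cite: BealsEtAl2001, §3] -/
noncomputable def unitaryAt (A : QQueryAlg N) (k : ℕ) :
    Matrix (Fin N × Bool × A.W) (Fin N × Bool × A.W) ℂ :=
  if h : k < A.queries + 1 then (A.unitaries ⟨k, h⟩ : Matrix _ _ ℂ) else 1

/-- Each `U_k` is unitary. [cite: BealsEtAl2001, §3] -/
theorem unitaryAt_mem (A : QQueryAlg N) (k : ℕ) :
    unitaryAt A k ∈ Matrix.unitaryGroup (Fin N × Bool × A.W) ℂ := by
  unfold unitaryAt
  split_ifs with h
  · exact (A.unitaries ⟨k, h⟩).2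
  · exact Submonoid.one_mem _

/-- The state `ψ_t^x = U_t O_x U_{t-1} O_x ⋯ O_x U_0 |start⟩` of `A` on input `x` after `t` query
rounds (BBBV's `|φ_t⟩`; Beals et al. §3). [cite: BealsEtAl2001, §3] -/
noncomputable def stateAt (A : QQueryAlg N) (x : Fin N → Bool) : ℕ → (Fin N × Bool × A.W → ℂ)
  | 0 => unitaryAt A 0 *ᵥ Pi.single A.start 1
  | t + 1 => unitaryAt A (t + 1) *ᵥ (queryOracle x *ᵥ stateAt A x t)

/-- The final state is the state after `T` rounds. [cite: BealsEtAl2001, §3] -/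
theorem finalState_eq_stateAt (A : QQueryAlg N) (x : Fin N → Bool) :
    A.finalState x = stateAt A x A.queries := by
  unfold QQueryAlg.finalState
  refine foldl_invariant A.queries
    (fun ψ j => (A.unitaries j.succ : Matrix _ _ ℂ) *ᵥ (queryOracle x *ᵥ ψ))
    ((A.unitaries 0 : Matrix _ _ ℂ) *ᵥ Pi.single A.start 1)
    (fun j ψ => ψ = stateAt A x j) ?_ ?_
  · show _ = unitaryAt A 0 *ᵥ Pi.single A.start 1
    rw [unitaryAt, dif_pos (Nat.succ_pos _)]
    rfl
  · intro j ψ hψ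
    rw [hψ]
    show _ = unitaryAt A (j + 1) *ᵥ (queryOracle x *ᵥ stateAt A x j)
    rw [unitaryAt, dif_pos (Nat.succ_lt_succ j.isLt)]
    rfl

/-- Every `ψ_t^x` is a unit vector. [cite: BealsEtAl2001, §3] -/
theorem l2Norm'_stateAt (A : QQueryAlg N) (x : Fin N → Bool) (t : ℕ) : l2Norm' (stateAt A x t) = 1 := by
  induction t with
  | zero =>
    rw [stateAt, l2Norm'_mulVec_of_mem_unitaryGroup (unitaryAt_mem A 0), l2Norm'_eq_sqrt,
      Finset.sum_eq_single A.start (fun s _ hs => by simp [hs]) (by simp)]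
    simp
  | succ t ih =>
    rw [stateAt, l2Norm'_mulVec_of_mem_unitaryGroup (unitaryAt_mem A (t + 1)),
      l2Norm'_mulVec_of_mem_unitaryGroup (queryOracle_mem_unitaryGroup x), ih]

/-! ### The hybrid argument -/

/-- One round: `‖ψ_{t+1}^x − ψ_{t+1}^y‖ ≤ ‖(O_x − O_y)ψ_t^x‖ + ‖ψ_t^x − ψ_t^y‖` (the same unitary
`U_{t+1}` is applied on both inputs; `O_y` is unitary). [cite: BennettBernsteinBrassardVazirani1997,
Thm 3.3 (proof)] -/
theorem l2Norm'_stateAt_succ_sub_le (A : QQueryAlg N) (x y : Fin N → Bool) (t : ℕ) :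
    l2Norm' (stateAt A x (t + 1) - stateAt A y (t + 1)) ≤
      l2Norm' (queryOracle x *ᵥ stateAt A x t - queryOracle y *ᵥ stateAt A x t) +
        l2Norm' (stateAt A x t - stateAt A y t) := by
  show l2Norm' (unitaryAt A (t + 1) *ᵥ (queryOracle x *ᵥ stateAt A x t) -
      unitaryAt A (t + 1) *ᵥ (queryOracle y *ᵥ stateAt A y t)) ≤ _
  rw [← Matrix.mulVec_sub, l2Norm'_mulVec_of_mem_unitaryGroup (unitaryAt_mem A (t + 1))]
  calc l2Norm' (queryOracle x *ᵥ stateAt A x t - queryOracle y *ᵥ stateAt A y t)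
      ≤ l2Norm' (queryOracle x *ᵥ stateAt A x t - queryOracle y *ᵥ stateAt A x t) +
          l2Norm' (queryOracle y *ᵥ stateAt A x t - queryOracle y *ᵥ stateAt A y t) :=
        l2Norm'_sub_le _ _ _
    _ = _ := by
        rw [← Matrix.mulVec_sub (queryOracle y),
          l2Norm'_mulVec_of_mem_unitaryGroup (queryOracle_mem_unitaryGroup y)]

/-- **The hybrid bound** (BBBV Thm. 3.3, telescoped): `‖ψ_T^x − ψ_T^y‖ ≤ ∑_{t<T} ‖(O_x − O_y)ψ_t^x‖`.
[cite: BennettBernsteinBrassardVazirani1997, Thm 3.3] -/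
theorem l2Norm'_stateAt_sub_le_sum (A : QQueryAlg N) (x y : Fin N → Bool) (T : ℕ) :
    l2Norm' (stateAt A x T - stateAt A y T) ≤
      ∑ t ∈ Finset.range T, l2Norm' (queryOracle x *ᵥ stateAt A x t - queryOracle y *ᵥ stateAt A x t) := by
  induction T with
  | zero =>
    have : stateAt A x 0 = stateAt A y 0 := rfl
    rw [this, sub_self, l2Norm'_zero, Finset.sum_range_zero]
  | succ T ih =>
    rw [Finset.sum_range_succ]
    linarith [l2Norm'_stateAt_succ_sub_le A x y T]

/-! ### Query magnitude and the cost of one modified query -/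

/-- The query magnitude of the block `B` in the state `ψ`: the squared weight of the basis states
whose index register points into `B` (BBBV Def. 3.2, summed over the block). [cite:
BennettBernsteinBrassardVazirani1997, Def 3.2] -/
noncomputable def queryMagnitude {W : Type*} [Fintype W] (B : Finset (Fin N))
    (ψ : Fin N × Bool × W → ℂ) : ℝ :=
  ∑ s, if s.1 ∈ B then ‖ψ s‖ ^ 2 else 0

/-- Query magnitudes are nonnegative. [folklore] -/
theorem queryMagnitude_nonneg {W : Type*} [Fintype W] (B : Finset (Fin N))
    (ψ : Fin N × Bool × W → ℂ) : 0 ≤ queryMagnitude B ψ :=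
  Finset.sum_nonneg fun s _ => by split_ifs <;> positivity

/-- The query magnitudes of pairwise disjoint blocks add up to at most `‖ψ‖₂²`. [cite:
BennettBernsteinBrassardVazirani1997, Cor 3.4 (proof)] -/
theorem sum_queryMagnitude_le {W : Type*} [Fintype W] {𝓑 : Finset (Finset (Fin N))}
    (h : (𝓑 : Set (Finset (Fin N))).PairwiseDisjoint id) (ψ : Fin N × Bool × W → ℂ) :
    ∑ B ∈ 𝓑, queryMagnitude B ψ ≤ ∑ s, ‖ψ s‖ ^ 2 := by
  unfold queryMagnitude
  rw [Finset.sum_comm]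
  refine Finset.sum_le_sum fun s _ => ?_
  rw [Finset.sum_ite, Finset.sum_const_zero, add_zero, Finset.sum_const, nsmul_eq_mul]
  have hcard : ((𝓑.filter fun B => s.1 ∈ B).card : ℝ) ≤ 1 := by
    norm_cast
    rw [Finset.card_le_one]
    intro B₁ hB₁ B₂ hB₂
    simp only [Finset.mem_filter] at hB₁ hB₂
    by_contra hne
    exact Finset.disjoint_left.mp (h hB₁.1 hB₂.1 hne) hB₁.2 hB₂.2
  calc _ ≤ 1 * ‖ψ s‖ ^ 2 := mul_le_mul_of_nonneg_right hcard (by positivity)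
    _ = _ := one_mul _

/-- One query to `x` versus one query to `x^B` on the same state: `‖O_x ψ − O_{x^B} ψ‖₂² ≤ 4 m_B(ψ)`
(the two oracles agree outside the block; inside, `|ψ(i,b,z) − ψ(i,¬b,z)|² ≤ 2|ψ(i,b,z)|² +
2|ψ(i,¬b,z)|²`). [cite: BennettBernsteinBrassardVazirani1997, Thm 3.3 (proof)] -/
theorem sum_norm_sq_oracle_sub_le {W : Type*} [Fintype W] [DecidableEq W] (x : Fin N → Bool)
    (B : Finset (Fin N)) (ψ : Fin N × Bool × W → ℂ) :
    ∑ s, ‖(queryOracle x *ᵥ ψ - queryOracle (flipBlock x B) *ᵥ ψ) s‖ ^ 2 ≤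
      4 * queryMagnitude B ψ := by
  set g : Fin N × Bool × W → ℝ := fun s => if s.1 ∈ B then ‖ψ s‖ ^ 2 else 0 with hg
  -- `|a - b|² ≤ 2|a|² + 2|b|²` (cf. `norm_sub_sq_le_two_mul` in `HybridArgument.lean`)
  have hineq : ∀ a b : ℂ, ‖a - b‖ ^ 2 ≤ 2 * ‖a‖ ^ 2 + 2 * ‖b‖ ^ 2 := fun a b => by
    have h := norm_sub_le a b
    have h0 := norm_nonneg (a - b)
    nlinarith [sq_nonneg (‖a‖ - ‖b‖), mul_le_mul h h h0 (by positivity)]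
  have hpt : ∀ s : Fin N × Bool × W,
      ‖(queryOracle x *ᵥ ψ - queryOracle (flipBlock x B) *ᵥ ψ) s‖ ^ 2 ≤
        2 * g (queryPerm x s) + 2 * g (queryPerm (flipBlock x B) s) := by
    intro s
    rw [Pi.sub_apply, queryOracle_mulVec_apply, queryOracle_mulVec_apply]
    by_cases hs : s.1 ∈ B
    · simp only [hg, queryPerm_apply, queryMap_apply, if_pos hs]
      exact hineq _ _
    · have hy : flipBlock x B s.1 = x s.1 := flipBlock_apply_of_not_mem hs
      simp only [hg, queryPerm_apply, queryMap_apply, if_neg hs, hy, sub_self, norm_zero]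
      norm_num
  have hsum : ∀ y : Fin N → Bool, ∑ s, g (queryPerm (W := W) y s) = queryMagnitude B ψ :=
    fun y => Equiv.sum_comp (queryPerm y) g
  calc ∑ s, ‖(queryOracle x *ᵥ ψ - queryOracle (flipBlock x B) *ᵥ ψ) s‖ ^ 2
      ≤ ∑ s, (2 * g (queryPerm x s) + 2 * g (queryPerm (flipBlock x B) s)) :=
        Finset.sum_le_sum fun s _ => hpt s
    _ = 4 * queryMagnitude B ψ := by
        rw [Finset.sum_add_distrib, ← Finset.mul_sum, ← Finset.mul_sum, hsum, hsum]
        ring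

/-- `‖O_x ψ − O_{x^B} ψ‖₂ ≤ 2 √(m_B(ψ))`. [cite: BennettBernsteinBrassardVazirani1997, Thm 3.3 (proof)] -/
theorem l2Norm'_oracle_sub_le {W : Type*} [Fintype W] [DecidableEq W] (x : Fin N → Bool)
    (B : Finset (Fin N)) (ψ : Fin N × Bool × W → ℂ) :
    l2Norm' (queryOracle x *ᵥ ψ - queryOracle (flipBlock x B) *ᵥ ψ) ≤
      2 * Real.sqrt (queryMagnitude B ψ) := by
  rw [l2Norm'_eq_sqrt]
  calc Real.sqrt (∑ s, ‖(queryOracle x *ᵥ ψ - queryOracle (flipBlock x B) *ᵥ ψ) s‖ ^ 2)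
      ≤ Real.sqrt (4 * queryMagnitude B ψ) := Real.sqrt_le_sqrt (sum_norm_sq_oracle_sub_le x B ψ)
    _ = 2 * Real.sqrt (queryMagnitude B ψ) := by
        rw [Real.sqrt_mul (by norm_num : (0 : ℝ) ≤ 4), show (4 : ℝ) = 2 ^ 2 by norm_num,
          Real.sqrt_sq (by norm_num : (0 : ℝ) ≤ 2)]

/-! ### Acceptance probabilities of nearby states -/

/-- Acceptance probabilities of two runs differ by at most twice the distance of the final states:
`|P(x) − P(y)| ≤ 2 ‖ψ_T^x − ψ_T^y‖₂` (a weak form of BBBV Thm. 3.1). [cite: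
BennettBernsteinBrassardVazirani1997, Thm 3.1] -/
theorem abs_acceptProb_sub_le (A : QQueryAlg N) (x y : Fin N → Bool) :
    |A.acceptProb x - A.acceptProb y| ≤ 2 * l2Norm' (A.finalState x - A.finalState y) := by
  classical
  set a := A.finalState x with ha
  set b := A.finalState y with hb
  have hsa : ∑ s, ‖a s‖ ^ 2 = 1 := sum_norm_sq_finalState A x
  have hsb : ∑ s, ‖b s‖ ^ 2 = 1 := sum_norm_sq_finalState A y
  have hpt : ∀ s, |‖a s‖ ^ 2 - ‖b s‖ ^ 2| ≤ ‖(a - b) s‖ * (‖a s‖ + ‖b s‖) := by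
    intro s
    rw [sq_sub_sq, abs_mul, abs_of_nonneg (by positivity), mul_comm, Pi.sub_apply]
    exact mul_le_mul_of_nonneg_right (abs_norm_sub_norm_le _ _) (by positivity)
  have hsq : ∑ s, (‖a s‖ + ‖b s‖) ^ 2 ≤ 4 := by
    calc ∑ s, (‖a s‖ + ‖b s‖) ^ 2 ≤ ∑ s, (2 * ‖a s‖ ^ 2 + 2 * ‖b s‖ ^ 2) :=
          Finset.sum_le_sum fun s _ => by nlinarith [sq_nonneg (‖a s‖ - ‖b s‖)]
      _ = 4 := by rw [Finset.sum_add_distrib, ← Finset.mul_sum, ← Finset.mul_sum, hsa, hsb]; norm_num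
  unfold QQueryAlg.acceptProb
  rw [← ha, ← hb, ← Finset.sum_sub_distrib]
  calc |∑ s with s ∈ A.accept, (‖a s‖ ^ 2 - ‖b s‖ ^ 2)|
      ≤ ∑ s with s ∈ A.accept, |‖a s‖ ^ 2 - ‖b s‖ ^ 2| := Finset.abs_sum_le_sum_abs _ _
    _ ≤ ∑ s, |‖a s‖ ^ 2 - ‖b s‖ ^ 2| :=
        Finset.sum_le_univ_sum_of_nonneg fun s => abs_nonneg _
    _ ≤ ∑ s, ‖(a - b) s‖ * (‖a s‖ + ‖b s‖) := Finset.sum_le_sum fun s _ => hpt s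
    _ ≤ Real.sqrt (∑ s, ‖(a - b) s‖ ^ 2) * Real.sqrt (∑ s, (‖a s‖ + ‖b s‖) ^ 2) :=
        Real.sum_mul_le_sqrt_mul_sqrt _ _ _
    _ ≤ l2Norm' (a - b) * 2 := by
        rw [← l2Norm'_eq_sqrt]
        refine mul_le_mul_of_nonneg_left ?_ (l2Norm'_nonneg _)
        rw [show (2 : ℝ) = Real.sqrt (2 ^ 2) from (Real.sqrt_sq (by norm_num)).symm]
        exact Real.sqrt_le_sqrt (by linarith)
    _ = 2 * l2Norm' (a - b) := mul_comm _ _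

/-! ### Block sensitivity versus the number of queries -/

/-- **The hybrid argument for block sensitivity** (Beals et al. Thm. 4.13 via BBBV Thm. 3.3): if
`A` computes the total function `f` with error `1/3` and `B_1, …, B_b` are pairwise disjoint
blocks all sensitive on the input `x`, then `b ≤ 144 T²`, `T` the number of queries of `A`.
[cite: BealsEtAl2001, Thm 4.13 (with the footnote preceding Thm 4.12)] -/
theorem card_le_of_isSensitiveFamily {A : QQueryAlg N} {f : (Fin N → Bool) → Bool}
    (hA : A.ComputesWithError (1 / 3) Set.univ f) {x : Fin N → Bool}
    {𝓑 : Finset (Finset (Fin N))} (h𝓑 : IsSensitiveFamily f x 𝓑) :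
    (𝓑.card : ℝ) ≤ 144 * (A.queries : ℝ) ^ 2 := by
  set T := A.queries with hT
  -- each sensitive block forces distance `1/6` between the final states
  have h1 : ∀ B ∈ 𝓑, (1 / 6 : ℝ) ≤
      ∑ t ∈ Finset.range T, 2 * Real.sqrt (queryMagnitude B (stateAt A x t)) := by
    intro B hB
    have hsens : f (flipBlock x B) ≠ f x := h𝓑.1 B hB
    have hdiff : (1 / 3 : ℝ) ≤ |A.acceptProb x - A.acceptProb (flipBlock x B)| := by
      cases hx : f x
      · have hx' : f (flipBlock x B) = true := by simpa [hx] using hsens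
        have h0 := (hA x (Set.mem_univ _)).2 hx
        have h1 := (hA (flipBlock x B) (Set.mem_univ _)).1 hx'
        rw [abs_sub_comm, abs_of_nonneg (by linarith)]
        linarith
      · have hx' : f (flipBlock x B) = false := by simpa [hx] using hsens
        have h0 := (hA x (Set.mem_univ _)).1 hx
        have h1 := (hA (flipBlock x B) (Set.mem_univ _)).2 hx'
        rw [abs_of_nonneg (by linarith)]
        linarith
    have h2 := abs_acceptProb_sub_le A x (flipBlock x B)
    rw [finalState_eq_stateAt, finalState_eq_stateAt] at h2
    calc (1 / 6 : ℝ) ≤ l2Norm' (stateAt A x T - stateAt A (flipBlock x B) T) := by linarith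
      _ ≤ ∑ t ∈ Finset.range T, l2Norm' (queryOracle x *ᵥ stateAt A x t -
            queryOracle (flipBlock x B) *ᵥ stateAt A x t) := l2Norm'_stateAt_sub_le_sum A x _ T
      _ ≤ _ := Finset.sum_le_sum fun t _ => l2Norm'_oracle_sub_le x B (stateAt A x t)
  -- at each time the magnitudes of the disjoint blocks sum to at most `1`, so by Cauchy–Schwarz
  have h2 : ∀ t, ∑ B ∈ 𝓑, Real.sqrt (queryMagnitude B (stateAt A x t)) ≤ Real.sqrt 𝓑.card := by
    intro t
    have hcs := Real.sum_sqrt_mul_sqrt_le 𝓑 (f := fun _ => (1 : ℝ))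
      (g := fun B => queryMagnitude B (stateAt A x t)) (fun _ => zero_le_one)
      (fun B => queryMagnitude_nonneg B _)
    simp only [Real.sqrt_one, one_mul, Finset.sum_const, nsmul_eq_mul, mul_one] at hcs
    have hm : ∑ B ∈ 𝓑, queryMagnitude B (stateAt A x t) ≤ 1 := by
      refine (sum_queryMagnitude_le h𝓑.2 _).trans ?_
      rw [← l2Norm'_sq, l2Norm'_stateAt, one_pow]
    calc _ ≤ Real.sqrt 𝓑.card * Real.sqrt (∑ B ∈ 𝓑, queryMagnitude B (stateAt A x t)) := hcs
      _ ≤ Real.sqrt 𝓑.card * 1 := by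
          refine mul_le_mul_of_nonneg_left ?_ (Real.sqrt_nonneg _)
          rw [← Real.sqrt_one]
          exact Real.sqrt_le_sqrt hm
      _ = _ := mul_one _
  -- summing over the blocks: `b/6 ≤ 2 T √b`
  have h3 : (𝓑.card : ℝ) / 6 ≤ 2 * T * Real.sqrt 𝓑.card := by
    calc (𝓑.card : ℝ) / 6 = ∑ B ∈ 𝓑, (1 / 6 : ℝ) := by
          rw [Finset.sum_const, nsmul_eq_mul]; ring
      _ ≤ ∑ B ∈ 𝓑, ∑ t ∈ Finset.range T, 2 * Real.sqrt (queryMagnitude B (stateAt A x t)) :=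
          Finset.sum_le_sum h1
      _ = ∑ t ∈ Finset.range T, 2 * ∑ B ∈ 𝓑, Real.sqrt (queryMagnitude B (stateAt A x t)) := by
          rw [Finset.sum_comm]
          refine Finset.sum_congr rfl fun t _ => ?_
          rw [Finset.mul_sum]
      _ ≤ ∑ t ∈ Finset.range T, 2 * Real.sqrt 𝓑.card :=
          Finset.sum_le_sum fun t _ => by linarith [h2 t]
      _ = 2 * T * Real.sqrt 𝓑.card := by
          rw [Finset.sum_const, Finset.card_range, nsmul_eq_mul]; ring
  have hsq : Real.sqrt (𝓑.card : ℝ) * Real.sqrt 𝓑.card = 𝓑.card :=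
    Real.mul_self_sqrt (Nat.cast_nonneg _)
  nlinarith [Real.sqrt_nonneg (𝓑.card : ℝ), hsq, h3, sq_nonneg (Real.sqrt (𝓑.card : ℝ) - 12 * T)]

/-- **Block sensitivity versus queries**: if `A` computes the total function `f` with error
`1/3` on every input then `bs(f) ≤ 144 T²` (Beals et al. Thm. 4.13, `Q₂(f) ≥ √(bs(f)/16)`, in
the constant the hybrid argument gives). [cite: BealsEtAl2001, Thm 4.13] -/
theorem blockSensitivity_le_of_computesWithError {A : QQueryAlg N} {f : (Fin N → Bool) → Bool}
    (hA : A.ComputesWithError (1 / 3) Set.univ f) :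
    (blockSensitivity f : ℝ) ≤ 144 * (A.queries : ℝ) ^ 2 := by
  obtain ⟨x, -, hx⟩ := Finset.exists_mem_eq_sup Finset.univ Finset.univ_nonempty
    (blockSensitivityAt f)
  obtain ⟨𝓑, h𝓑, hcard⟩ := exists_family_card_eq f x
  rw [blockSensitivity, hx, ← hcard]
  exact card_le_of_isSensitiveFamily hA h𝓑

/-- **Block sensitivity versus bounded-error quantum query complexity** (Beals et al. Thm. 4.13,
`Q₂(f) ≥ √(bs(f)/16)`, in the constant of the hybrid argument): `bs(f) ≤ 144 Q₂(f)²` for every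
total Boolean function on `N ≥ 1` bits (an optimal algorithm exists by
`exists_queries_eq_quantumQueryComplexityOn`). [cite: BealsEtAl2001, Thm 4.13] -/
theorem blockSensitivity_le_quantumQueryComplexity_sq [NeZero N] (f : (Fin N → Bool) → Bool) :
    (blockSensitivity f : ℝ) ≤ 144 * (quantumQueryComplexity (1 / 3) f : ℝ) ^ 2 := by
  obtain ⟨A, hAq, hA⟩ :=
    exists_queries_eq_quantumQueryComplexityOn (by norm_num : (0 : ℝ) ≤ 1 / 3) Set.univ f
  rw [quantumQueryComplexity, ← hAq]
  exact blockSensitivity_le_of_computesWithError hA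

end Literature.Computability.QuantumComplexity
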